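import Summits.QuantumFields.YangMills.Theorems.FluctuationComparisonRegPrIntLS2BetaRelativeTowerSupProfile
import Summits.QuantumFields.YangMills.Theorems.FluctuationComparisonRegPrIntLS2BetaWhitneyHatLiftCurvatureAllOrders
import HarnessLib

/-!
# S2β · (L♭) road, way-out (a) — D5′: THE `s`-STEP OF THE TWO-PROFILE SUP RECURSION WITH THE ALL-ORDERS LIFT LETTER (D6):
# `arc (W b) ≤ L⁻¹·s + (π∕2)·( N_P·(aW + L⁻²·(π²∕4·(aX + 4v) + 4v + 16sv)) + ((d+2)L)²∕2·aW )` for `s ≤ π∕2` — NO pure-size term, NO chart guard (`d = 3`)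

Cell `ym3-torus` (rung R3 = continuum `SU(2)` Yang–Mills on the three-torus — NOT d = 4, NOT infinite volume, NOT a mass gap, NOT Clay).
Width seat «width 12» `ym3-torus-px12` (gen 25); `--kind proof --supports stmt-QuantumFields-20520 --as helper`, count-neutral, DEFINITION-FREE
(0 `def`, 0 `instance`, 0 `notation`, 0 `sorry`, default heartbeats).  ONE theorem: px21 g23's ✓p828064 `…RelativeTowerSupProfileVar.arc_le_sup_step_hatLift_var`
with ONE input replaced — the lift's plaquettes are read by this seat's ✓∕⧗`…WhitneyHatLiftCurvatureAllOrders.dist1_plaqHol_lift_le_allOrders_of_forall`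
(`(L⁻¹)²·(π²∕4·(aX + 4v) + 4v + 16sv)`, arcs `s ≤ π∕2`) instead of D4's `(L⁻¹)²·(aX + (aX+12s²)² + 40sv + 8v² + 35s³)` (`s ≤ 1∕4`) — px21's «D4 by `exact` in its `hVp` line».

WHY (px21 g23 ■ FINAL «RECOMMENDED NEXT: D6 … then the `v`-STEP»; UV3-NODE §91, §84.9).  With D6 the `s`-recursion reads
`s_t ≤ L⁻¹s_{t+1} + ρ_t + κ·(π² + 4 + 16 s_{t+1})·v_{t+1}`, `κ = (π∕2)·N_P·L⁻²`, `ρ_t` a threshold sum (`aW`, `aX`) — LINEAR in `v`, NO power of `s` alone, valid up to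
`s ≤ π∕2` (the Polyakov floor `π∕N_J ≤ π∕10` of the smallest top geometry is inside).  The `v`-STEP (variation of the comb-axial correction factors) remains the one open
kinematic file of way-out (a); it decides (a) by a contraction number, not a start threshold.  This serves the SMALL-`N_J` end of the (D-stage) guard only (§84.9).

HONEST SCOPE.  Plumbing over landed letters; every constant explicit and crude; nothing of Bałaban's analysis asserted ([Balaban1985RegularSpaces] Lemma 1 (1.24)–(1.26)
p.79, (1.29) p.81 served); the `v`-step, the top small-variation gauge, (L♭)'s start, (D-stage) at the bare guards, GAP♯∘ (registry 3732b7df UNTOUCHED), S2β, crux 20520 and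
`YM3TorusSU2` NOT proved; no registered stub closed; rung R3 = SU(2) YM₃ on T³ — NOT d = 4, NOT infinite volume, NOT a mass gap, NOT Clay; the Yang–Mills mass gap is NOT proved.
References: T. Bałaban, CMP **99** (1985) 75–102 [Balaban1985RegularSpaces]; CMP **98** (1985) 17–51 [Balaban1985Averaging]; CMP **109** (1987) 249–301 [Balaban1987RG1].
-/

set_option autoImplicit false

noncomputable section

namespace Summit.QuantumFields.YangMills.Theorems.FluctuationComparisonRegPrIntLS2BetaRelativeTowerSupProfileVarAllOrders

open Finset
open scoped Real
open Literature.MathematicalPhysics.QuantumLattice (su2Quat)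
open Literature.MathematicalPhysics.QuantumFieldTheory.Balaban1983to89
open T4Continuum BlockAveraging LatticeWordStokes
open B10Eq27TorusAxialLog (rel axialT)
open T4CubeChartGnomonic (SU2)
open T4HaarSU2ExpChart (expPoint)
open T4ExpWindowSmallField (logVec)
open Summit.QuantumFields.YangMills.Theorems.FluctuationComparisonRegPrIntLS2BetaRelativeFieldLetter (dist1_axialAvg_mul_inv_eq_corr)
open Summit.QuantumFields.YangMills.Theorems.FluctuationComparisonRegPrIntLS2BetaWhitneyHatLift (arc_lift_le axialAvg_lift)
open Summit.QuantumFields.YangMills.Theorems.FluctuationComparisonRegPrIntLS2BetaRelativeTowerSupProfile (arc_le_of_axial_pair)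
open Summit.QuantumFields.YangMills.Theorems.FluctuationComparisonRegPrIntLS2BetaWhitneyHatLiftCurvatureAllOrders (dist1_plaqHol_lift_le_allOrders_of_forall)

variable {P : Params}

/-- ★★★ **THE `s`-STEP OF THE TWO-PROFILE SUP RECURSION WITH THE ALL-ORDERS LIFT LETTER** (px21 g23's ✓p828064 `arc_le_sup_step_hatLift_var` VERBATIM in mechanism and
hypotheses — comb bonds carry the lift ✓`arc_lift_le`, the others add fluxes ✓`arc_le_of_axial_pair`, spine quotient = correction factor — with the lift's plaquettes read by
✓`dist1_plaqHol_lift_le_allOrders_of_forall` (D6) instead of ✓`dist1_plaqHol_lift_le_second_of_forall` (D4)): for `s ≤ π∕2` (NO `1∕4` chart guard),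
`arc (W b) ≤ L⁻¹·s + (π∕2)·( N_P·(aW + L⁻²·(π²∕4·(aX + 4v) + 4v + 16sv)) + ((d+2)L)²∕2·aW )` — NO `s²`, NO `s³`, NO `s⁴`: every lift term carries `aX` or `v`.
[cite: Balaban1985RegularSpaces, Lemma 1 (1.24)-(1.26) p.79, (1.29) p.81] -/
theorem arc_le_sup_step_hatLift_allOrders (hd : P.d = 3) {t : ℕ} (ht : t + 1 ≤ P.m + P.K) (w : PBond P t → PBond P (t + 1) → ℝ)
    (hw : ∀ b e, w b e = if e.dir = b.dir ∧ (b.src b.dir - emb e.src b.dir).val < P.L then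
      ∏ ν ∈ Finset.univ.erase b.dir, max 0 (1 - ((rel (emb e.src) b.src ν).natAbs : ℝ) / P.L) else 0)
    (X : GaugeField P (t + 1) SU2) (V : GaugeField P t SU2)
    (hV : ∀ b, V b = expPoint (∑ e, w b e • ((P.L : ℝ)⁻¹ • logVec (su2Quat (X e)))))
    (W : GaugeField P t SU2)
    (hax : ∀ z : Site P t, axialT W (emb (blockOf z)) z = axialT V (emb (blockOf z)) z)
    (hT5 : avgFun T3UnitLawDensityEML.ℰp W = X)
    {aW aX s v : ℝ} (haW : 0 ≤ aW) (hWs : PlaqSmall aW W)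
    (hg1 : ((((P.d + 2) * P.L : ℕ) : ℝ) ^ 2 / 4) * aW < ExpMeanLog.deltaSU (Fin 2))
    (hg2 : ((((P.d + 2) * P.L : ℕ) : ℝ) ^ 2 / 4) * aW ≤ 1 / 6)
    (hXp : ∀ q : Plaq P (t + 1), dist1 (GaugeField.plaqHol X q) ≤ aX)
    (hs : ∀ e : PBond P (t + 1), ‖logVec (su2Quat (X e))‖ ≤ s) (hs2 : s ≤ π / 2)
    (hv : ∀ (y : Site P (t + 1)) (ι κ : Fin P.d), ι ≠ κ →
      ‖logVec (su2Quat (X ⟨y.shift ι, κ⟩)) - logVec (su2Quat (X ⟨y, κ⟩))‖ ≤ v)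
    (b : PBond P t) :
    ‖logVec (su2Quat (W b))‖ ≤ (P.L : ℝ)⁻¹ * s +
      π / 2 * ((((P.d - 1) * ((P.L - 1) / 2) * (P.L + 1) : ℕ) : ℝ) *
          (aW + ((P.L : ℝ)⁻¹) ^ 2 * (π ^ 2 / 4 * (aX + 4 * v) + 4 * v + 16 * s * v)) +
        2 * (((((P.d + 2) * P.L : ℕ) : ℝ) ^ 2 / 4) * aW)) := by
  obtain ⟨e₀⟩ : Nonempty (PBond P (t + 1)) := ⟨⟨default, ⟨0, P.hd⟩⟩⟩
  have hs0 : 0 ≤ s := (norm_nonneg _).trans (hs e₀)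
  have hv0 : 0 ≤ v := (norm_nonneg _).trans (hv default ⟨0, P.hd⟩ ⟨1, by rw [hd]; norm_num⟩ (by simp [Fin.ext_iff]))
  have haX : 0 ≤ aX := (GaugeGroup.dist1_nonneg _).trans (hXp ⟨default, ⟨0, P.hd⟩, ⟨1, by rw [hd]; norm_num⟩, by simp [Fin.lt_def]⟩)
  -- plaquettes of `W`
  have hWp : ∀ p : Plaq P t, dist1 (GaugeField.plaqHol W p) ≤ aW := fun p => (hWs p).le
  -- plaquettes of the lift: THE ALL-ORDERS REFINED LETTER (global two-profile form, D6)
  have hVp : ∀ p : Plaq P t, dist1 (GaugeField.plaqHol V p)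
      ≤ ((P.L : ℝ)⁻¹) ^ 2 * (π ^ 2 / 4 * (aX + 4 * v) + 4 * v + 16 * s * v) := fun p =>
    dist1_plaqHol_lift_le_allOrders_of_forall hd ht w hw X V hV hs hs2 hXp hv p
  -- bonds of the lift
  have hVb : ∀ b : PBond P t, ‖logVec (su2Quat (V b))‖ ≤ (P.L : ℝ)⁻¹ * s := fun b =>
    arc_lift_le ht w hw X V hV b fun e _ => hs e
  -- spine quotient = correction factor ≤ 2·(loop bound)
  have havg : ∀ c : PBond P (t + 1), AveragingRT.axialAvg V c = avgFun T3UnitLawDensityEML.ℰp W c := fun c => by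
    rw [axialAvg_lift ht w hw X V hV, hT5]
  have hsp : ∀ c : PBond P (t + 1), dist1 (AveragingRT.axialAvg W c * (AveragingRT.axialAvg V c)⁻¹) ≤
      2 * (((((P.d + 2) * P.L : ℕ) : ℝ) ^ 2 / 4) * aW) := fun c => by
    rw [dist1_axialAvg_mul_inv_eq_corr _ W V c (havg c)]
    exact BlockAveragingEMLProp2.dist1_corr_le_two_mul W c (fun i => dist1_loopHol_le haW hWs c i) hg1 hg2
  have hU0 : 0 ≤ ((P.L : ℝ)⁻¹) ^ 2 * (π ^ 2 / 4 * (aX + 4 * v) + 4 * v + 16 * s * v) := by positivity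
  have hS0 : 0 ≤ 2 * (((((P.d + 2) * P.L : ℕ) : ℝ) ^ 2 / 4) * aW) := by positivity
  exact arc_le_of_axial_pair ht W V hax haW hU0 hS0 hWp hVp hsp hVb b

end Summit.QuantumFields.YangMills.Theorems.FluctuationComparisonRegPrIntLS2BetaRelativeTowerSupProfileVarAllOrders

end
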